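import Summits.HodgeConjecture.CorCM.Census.CentralSquaresNearLattice

/-!
# The square-central class, XXIV: residual closure of the four-type block UP TO `2ᵏ`

COR-CM (cell `pub-hodgecm2`), count-neutral kernel combinatorics by the binder seat b09 (gen 46; lane SQUARE-CENTRAL CLASS, part XXIV), on part II
(`Census/CentralSquaresNearLattice.lean`: star defects `ρ(X) = [X] − θ_{T₀}(typeSum [X])`, `two_pow_smul_mem_of_defects`, `defect_*`) BY NAME.  Theorems only: no
definition, no `decide`, no certificate, no named fact, no `sorry`.  HONEST FRAMING: `HC_CM` is NOT proved, here or anywhere in the tree; nothing here is a period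
or a headline.

Part II §2–3 (`residual_closure_four`) closes the residual lattice of a four-type base block `{T₀, T̄₀, T₁, T̄₁}` up to `2` from the DOUBLED classes `2Y_s`, `2Y'_s`,
one transversal relation `R(T)` and one `Rᶜ(T')`.  The order-`4` swap rows (`ℤ/4 ⋊ ℤ/4` with `c = a²` or `a²y²`, design note `CENTRAL-SQUARES-M2.md` §5) reach the
classes `Y_s`, `Y'_s` only up to `4`: this file is the same computation with an arbitrary integer multiplier `N` (§1) and the closure up to `2ᵏ` (§2,
`residual_closure_four_pow`: pairs, `2ᵏY_s`, `2ᵏY'_s`, one `R(T)`, one `Rᶜ(T')` ⟹ `2ᵏ·y ∈ L` for every residual Hodge vector `y`).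

Notation (`e₀ = [T₀]`, `e₁ = [T₁]`, `f_s = [T₀^{(s)}]`, `g_s = [T₁^{(s)}]`, `𝓗 = T₀ ∖ T₁` of size `2m`, `𝓗ᶜ = T₀ ∩ T₁` of size `2m`):
`Y_s = (f_s − e₀) + (g_s − e₁)`, `Y'_s = (f_s − e₀) − (g_s − e₁)`, `R(T) = Σ_{t ∈ T} f_t − Σ_{u ∈ 𝓗∖T} g_u − (m−1)(e₀ − e₁)`,
`Rᶜ(T') = Σ_{t ∈ T'} f_t + Σ_{u ∈ 𝓗ᶜ∖T'} g_u − (m−1)(e₀ + e₁)`.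

## References
* [Pohlmann1968] H. Pohlmann, Algebraic cycles on abelian varieties of complex multiplication type, Ann. of Math. 88 (1968), Thm 1.
-/

namespace Summit.HodgeConjecture.CorCM.Census.CentralSquares

open Finset
open scoped symmDiff
open Summit.HodgeConjecture.CorCM.Prior.AllgGroup.RfwfAllgGroup
open Summit.HodgeConjecture.CorCM.Census.BlockParity
open Summit.HodgeConjecture.CorCM.Census.Coinvariant
open Summit.HodgeConjecture.CorCM.Census.TwistGeneration
open Summit.HodgeConjecture.CorCM.Census.BaseBlock

noncomputable section

variable {G : Type*} [Group G] [Fintype G] [DecidableEq G] (c : G)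

/-! ## §1 The four base defects with an arbitrary multiplier `N` -/

section Four

variable (hc2 : c * c = 1) (T₀ T₁ : CMF G c)

/-- **`Nρ(T₁) ∈ L`** from one transversal relation `R(T)` on `𝓗 = T₀ ∖ T₁` and the classes `NY_t` (`t ∈ 𝓗 ∖ T`):
`Nρ(T₁) = −NR(T) − Σ_{t ∈ 𝓗∖T} NY_t` when `|𝓗| = 2m`, `|T| = m`. [folklore] -/
theorem smul_defect_T₁_mem (L : Submodule ℤ (CMF G c →₀ ℤ)) (N : ℤ) (m : ℕ) (hH : (T₀.1 \ T₁.1).card = 2 * m)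
    {T : Finset G} (hT : T ⊆ T₀.1 \ T₁.1) (hTm : T.card = m)
    (hR : ∑ s ∈ T, Finsupp.single (oflipCM c hc2 s T₀) (1 : ℤ) - ∑ u ∈ (T₀.1 \ T₁.1) \ T, Finsupp.single (oflipCM c hc2 u T₁) (1 : ℤ) -
      ((m : ℤ) - 1) • (Finsupp.single T₀ (1 : ℤ) - Finsupp.single T₁ 1) ∈ L)
    (hNY : ∀ t ∈ (T₀.1 \ T₁.1) \ T, N • ((Finsupp.single (oflipCM c hc2 t T₀) (1 : ℤ) - Finsupp.single T₀ 1) +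
      (Finsupp.single (oflipCM c hc2 t T₁) (1 : ℤ) - Finsupp.single T₁ 1)) ∈ L) :
    N • (Finsupp.single T₁ 1 - thetaG c hc2 T₀ (typeSum G c (Finsupp.single T₁ 1))) ∈ L := by
  set e₀ : CMF G c →₀ ℤ := Finsupp.single T₀ 1 with he₀
  set e₁ : CMF G c →₀ ℤ := Finsupp.single T₁ 1 with he₁
  set f : G → (CMF G c →₀ ℤ) := fun s => Finsupp.single (oflipCM c hc2 s T₀) 1 with hf
  set g : G → (CMF G c →₀ ℤ) := fun s => Finsupp.single (oflipCM c hc2 s T₁) 1 with hg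
  have hcardD : (((T₀.1 \ T₁.1) \ T).card : ℤ) = m := by
    have h : ((T₀.1 \ T₁.1) \ T).card = m := by rw [card_sdiff_of_subset hT, hH, hTm]; omega
    exact_mod_cast h
  have hsumf : ∑ t ∈ T₀.1 \ T₁.1, f t = ∑ t ∈ (T₀.1 \ T₁.1) \ T, f t + ∑ t ∈ T, f t := (Finset.sum_sdiff hT).symm
  -- the identity `Nρ(T₁) = −NR − Σ NY`
  have key : N • (e₁ - ((∑ t ∈ T₀.1 \ T₁.1, (f t - e₀)) + e₀)) =
      -(N • (∑ s ∈ T, f s - ∑ u ∈ (T₀.1 \ T₁.1) \ T, g u - ((m : ℤ) - 1) • (e₀ - e₁))) -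
        ∑ t ∈ (T₀.1 \ T₁.1) \ T, N • ((f t - e₀) + (g t - e₁)) := by
    rw [Finset.sum_sub_distrib, Finset.sum_const, hH, hsumf]
    rw [show ∑ t ∈ (T₀.1 \ T₁.1) \ T, N • ((f t - e₀) + (g t - e₁)) =
        N • (∑ t ∈ (T₀.1 \ T₁.1) \ T, f t) + N • (∑ t ∈ (T₀.1 \ T₁.1) \ T, g t) -
          (N * (m : ℤ)) • e₀ - (N * (m : ℤ)) • e₁ from by
      rw [← Finset.smul_sum, Finset.sum_add_distrib, Finset.sum_sub_distrib, Finset.sum_sub_distrib, Finset.sum_const,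
        Finset.sum_const, smul_add, smul_sub, smul_sub]
      rw [← Nat.cast_smul_eq_nsmul ℤ, ← Nat.cast_smul_eq_nsmul ℤ, hcardD, smul_smul, smul_smul]
      module]
    rw [← Nat.cast_smul_eq_nsmul ℤ (2 * m)]
    push_cast
    module
  have h := Submodule.sub_mem _ (Submodule.neg_mem _ (Submodule.smul_mem _ N hR)) (Submodule.sum_mem _ fun t ht => hNY t ht)
  rw [thetaG_typeSum_single c T₀ hc2]
  rw [← key] at h
  exact h

/-- **The `𝓗ᶜ`-class `σ₁ = −e₁ − e₀ − Σ_{t ∈ 𝓗ᶜ} (f_t − e₀)` is in `L` up to `N`**: `Nσ₁ = −NRᶜ(T') − Σ_{t ∈ 𝓗ᶜ∖T'} NY'_t` (`|𝓗ᶜ| = 2m`, `|T'| = m`). [folklore] -/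
theorem smul_sigma_mem (L : Submodule ℤ (CMF G c →₀ ℤ)) (N : ℤ) (m : ℕ) (hHc : (T₀.1 ∩ T₁.1).card = 2 * m)
    {T' : Finset G} (hT' : T' ⊆ T₀.1 ∩ T₁.1) (hT'm : T'.card = m)
    (hRc : ∑ s ∈ T', Finsupp.single (oflipCM c hc2 s T₀) (1 : ℤ) + ∑ u ∈ (T₀.1 ∩ T₁.1) \ T', Finsupp.single (oflipCM c hc2 u T₁) (1 : ℤ) -
      ((m : ℤ) - 1) • (Finsupp.single T₀ (1 : ℤ) + Finsupp.single T₁ 1) ∈ L)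
    (hNY' : ∀ t ∈ (T₀.1 ∩ T₁.1) \ T', N • ((Finsupp.single (oflipCM c hc2 t T₀) (1 : ℤ) - Finsupp.single T₀ 1) -
      (Finsupp.single (oflipCM c hc2 t T₁) (1 : ℤ) - Finsupp.single T₁ 1)) ∈ L) :
    N • (-Finsupp.single T₁ (1 : ℤ) - Finsupp.single T₀ 1 -
      ∑ t ∈ T₀.1 ∩ T₁.1, (Finsupp.single (oflipCM c hc2 t T₀) (1 : ℤ) - Finsupp.single T₀ 1)) ∈ L := by
  set e₀ : CMF G c →₀ ℤ := Finsupp.single T₀ 1 with he₀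
  set e₁ : CMF G c →₀ ℤ := Finsupp.single T₁ 1 with he₁
  set f : G → (CMF G c →₀ ℤ) := fun s => Finsupp.single (oflipCM c hc2 s T₀) 1 with hf
  set g : G → (CMF G c →₀ ℤ) := fun s => Finsupp.single (oflipCM c hc2 s T₁) 1 with hg
  have hcardD : (((T₀.1 ∩ T₁.1) \ T').card : ℤ) = m := by
    have h : ((T₀.1 ∩ T₁.1) \ T').card = m := by rw [card_sdiff_of_subset hT', hHc, hT'm]; omega
    exact_mod_cast h
  have hsumf : ∑ t ∈ T₀.1 ∩ T₁.1, f t = ∑ t ∈ (T₀.1 ∩ T₁.1) \ T', f t + ∑ t ∈ T', f t := (Finset.sum_sdiff hT').symm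
  have key : N • (-e₁ - e₀ - ∑ t ∈ T₀.1 ∩ T₁.1, (f t - e₀)) =
      -(N • (∑ s ∈ T', f s + ∑ u ∈ (T₀.1 ∩ T₁.1) \ T', g u - ((m : ℤ) - 1) • (e₀ + e₁))) -
        ∑ t ∈ (T₀.1 ∩ T₁.1) \ T', N • ((f t - e₀) - (g t - e₁)) := by
    rw [Finset.sum_sub_distrib, Finset.sum_const, hHc, hsumf]
    rw [show ∑ t ∈ (T₀.1 ∩ T₁.1) \ T', N • ((f t - e₀) - (g t - e₁)) =
        N • (∑ t ∈ (T₀.1 ∩ T₁.1) \ T', f t) - N • (∑ t ∈ (T₀.1 ∩ T₁.1) \ T', g t) -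
          (N * (m : ℤ)) • e₀ + (N * (m : ℤ)) • e₁ from by
      rw [← Finset.smul_sum, Finset.sum_sub_distrib, Finset.sum_sub_distrib, Finset.sum_sub_distrib, Finset.sum_const,
        Finset.sum_const, smul_sub, smul_sub, smul_sub]
      rw [← Nat.cast_smul_eq_nsmul ℤ, ← Nat.cast_smul_eq_nsmul ℤ, hcardD, smul_smul, smul_smul]
      module]
    rw [← Nat.cast_smul_eq_nsmul ℤ (2 * m)]
    push_cast
    module
  have h := Submodule.sub_mem _ (Submodule.neg_mem _ (Submodule.smul_mem _ N hRc)) (Submodule.sum_mem _ fun t ht => hNY' t ht)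
  rw [← key] at h
  exact h

/-- **`Nρ(T̄₀) ∈ L`**: `ρ(T̄₀) = pair T₀ + ρ(T₁) + σ₁` since `T₀ = 𝓗 ⊔ 𝓗ᶜ`. [folklore] -/
theorem smul_defect_compl_T₀_mem (hcen : ∀ x : G, x * c = c * x) (L : Submodule ℤ (CMF G c →₀ ℤ)) (hP : ∀ Ψ : CMF G c, pair c Ψ ∈ L) (N : ℤ)
    (hρ₁ : N • (Finsupp.single T₁ 1 - thetaG c hc2 T₀ (typeSum G c (Finsupp.single T₁ 1))) ∈ L)
    (hσ : N • (-Finsupp.single T₁ (1 : ℤ) - Finsupp.single T₀ 1 -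
      ∑ t ∈ T₀.1 ∩ T₁.1, (Finsupp.single (oflipCM c hc2 t T₀) (1 : ℤ) - Finsupp.single T₀ 1)) ∈ L) :
    N • (Finsupp.single (rt c c T₀) 1 - thetaG c hc2 T₀ (typeSum G c (Finsupp.single (rt c c T₀) 1))) ∈ L := by
  have hT : T₀.1 \ (rt c c T₀).1 = T₀.1 := by rw [dev_compl c hcen, Finset.sdiff_self, Finset.sdiff_empty]
  have hsplit : ∑ t ∈ T₀.1, (Finsupp.single (oflipCM c hc2 t T₀) (1 : ℤ) - Finsupp.single T₀ 1) =
      ∑ t ∈ T₀.1 \ T₁.1, (Finsupp.single (oflipCM c hc2 t T₀) (1 : ℤ) - Finsupp.single T₀ 1) +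
        ∑ t ∈ T₀.1 ∩ T₁.1, (Finsupp.single (oflipCM c hc2 t T₀) (1 : ℤ) - Finsupp.single T₀ 1) := by
    rw [← Finset.sum_union (disjoint_sdiff_inter T₀.1 T₁.1), sdiff_union_inter]
  have hc0 : Finsupp.single (rt c c T₀) (1 : ℤ) = pair c T₀ - Finsupp.single T₀ 1 := by rw [pair, add_sub_cancel_left]
  have key : N • (Finsupp.single (rt c c T₀) 1 - thetaG c hc2 T₀ (typeSum G c (Finsupp.single (rt c c T₀) 1))) =
      N • pair c T₀ + N • (Finsupp.single T₁ 1 - thetaG c hc2 T₀ (typeSum G c (Finsupp.single T₁ 1))) +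
        N • (-Finsupp.single T₁ (1 : ℤ) - Finsupp.single T₀ 1 -
          ∑ t ∈ T₀.1 ∩ T₁.1, (Finsupp.single (oflipCM c hc2 t T₀) (1 : ℤ) - Finsupp.single T₀ 1)) := by
    rw [thetaG_typeSum_single c T₀ hc2, thetaG_typeSum_single c T₀ hc2, hT, hsplit, hc0]
    module
  rw [key]
  exact Submodule.add_mem _ (Submodule.add_mem _ (Submodule.smul_mem _ _ (hP T₀)) hρ₁) hσ

/-- **`Nρ(T₁^{(s)}) ∈ L` for `s ∈ 𝓗`**: `ρ(T₁^{(s)}) = ρ(T₁) + Y_s`. [folklore] -/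
theorem smul_defect_oflipCM_T₁_mem_of_mem_sdiff (L : Submodule ℤ (CMF G c →₀ ℤ)) (N : ℤ) {s : G} (hs : s ∈ T₀.1 \ T₁.1)
    (hρ₁ : N • (Finsupp.single T₁ 1 - thetaG c hc2 T₀ (typeSum G c (Finsupp.single T₁ 1))) ∈ L)
    (hNY : N • ((Finsupp.single (oflipCM c hc2 s T₀) (1 : ℤ) - Finsupp.single T₀ 1) +
      (Finsupp.single (oflipCM c hc2 s T₁) (1 : ℤ) - Finsupp.single T₁ 1)) ∈ L) :
    N • (Finsupp.single (oflipCM c hc2 s T₁) 1 - thetaG c hc2 T₀ (typeSum G c (Finsupp.single (oflipCM c hc2 s T₁) 1))) ∈ L := by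
  rw [defect_oflipCM_of_not_mem c hc2 T₀ T₁ (mem_sdiff.mp hs).1 (mem_sdiff.mp hs).2, add_assoc, smul_add, add_comm
    (Finsupp.single (oflipCM c hc2 s T₁) 1 - Finsupp.single T₁ 1)]
  exact Submodule.add_mem _ hρ₁ hNY

/-- **`Nρ(T₁^{(s)}) ∈ L` for `s ∈ 𝓗ᶜ`**: `ρ(T₁^{(s)}) = ρ(T₁) − Y'_s`. [folklore] -/
theorem smul_defect_oflipCM_T₁_mem_of_mem_inter (L : Submodule ℤ (CMF G c →₀ ℤ)) (N : ℤ) {s : G} (hs : s ∈ T₀.1 ∩ T₁.1)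
    (hρ₁ : N • (Finsupp.single T₁ 1 - thetaG c hc2 T₀ (typeSum G c (Finsupp.single T₁ 1))) ∈ L)
    (hNY' : N • ((Finsupp.single (oflipCM c hc2 s T₀) (1 : ℤ) - Finsupp.single T₀ 1) -
      (Finsupp.single (oflipCM c hc2 s T₁) (1 : ℤ) - Finsupp.single T₁ 1)) ∈ L) :
    N • (Finsupp.single (oflipCM c hc2 s T₁) 1 - thetaG c hc2 T₀ (typeSum G c (Finsupp.single (oflipCM c hc2 s T₁) 1))) ∈ L := by
  have e : Finsupp.single (oflipCM c hc2 s T₁) 1 - thetaG c hc2 T₀ (typeSum G c (Finsupp.single (oflipCM c hc2 s T₁) 1)) =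
      (Finsupp.single T₁ 1 - thetaG c hc2 T₀ (typeSum G c (Finsupp.single T₁ 1))) -
        ((Finsupp.single (oflipCM c hc2 s T₀) (1 : ℤ) - Finsupp.single T₀ 1) -
          (Finsupp.single (oflipCM c hc2 s T₁) (1 : ℤ) - Finsupp.single T₁ 1)) := by
    rw [defect_oflipCM_of_mem c hc2 T₀ T₁ (mem_inter.mp hs).1 (mem_inter.mp hs).2]
    abel
  rw [e, smul_sub]
  exact Submodule.sub_mem _ hρ₁ hNY'

end Four

/-! ## §2 Residual closure of the four-type block up to `2ᵏ` -/

/-- **RESIDUAL CLOSURE OF THE FOUR-TYPE BLOCK UP TO `2ᵏ`.**  Central involution `c ≠ 1`, base types `T₀`, `T₁` with `|T₀ ∖ T₁| = |T₀ ∩ T₁| = 2m`; a lattice `L`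
containing all pairs, the classes `2ᵏY_s` (`s ∈ T₀ ∖ T₁`), `2ᵏY'_s` (`s ∈ T₀ ∩ T₁`), one transversal relation `R(T)` (`T ⊆ T₀ ∖ T₁`, `|T| = m`) and one
`Rᶜ(T')` (`T' ⊆ T₀ ∩ T₁`, `|T'| = m`).  Then `2ᵏy ∈ L` for every Hodge vector `y` supported on `T₀`, `T₁`, their complements and the single flips of these four
types.  (`k = 1` is part IIʼs `residual_closure_four`; the order-`4` swap rows use `k = 2`.) [folklore] -/
theorem residual_closure_four_pow (hc2 : c * c = 1) (hc1 : c ≠ 1) (hcen : ∀ x : G, x * c = c * x) (T₀ T₁ : CMF G c)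
    (L : Submodule ℤ (CMF G c →₀ ℤ)) (hP : ∀ Ψ : CMF G c, pair c Ψ ∈ L) (k m : ℕ)
    (hH : (T₀.1 \ T₁.1).card = 2 * m) (hHc : (T₀.1 ∩ T₁.1).card = 2 * m)
    (hY : ∀ s ∈ T₀.1 \ T₁.1, ((2 : ℤ) ^ k) • ((Finsupp.single (oflipCM c hc2 s T₀) (1 : ℤ) - Finsupp.single T₀ 1) +
      (Finsupp.single (oflipCM c hc2 s T₁) (1 : ℤ) - Finsupp.single T₁ 1)) ∈ L)
    (hY' : ∀ s ∈ T₀.1 ∩ T₁.1, ((2 : ℤ) ^ k) • ((Finsupp.single (oflipCM c hc2 s T₀) (1 : ℤ) - Finsupp.single T₀ 1) -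
      (Finsupp.single (oflipCM c hc2 s T₁) (1 : ℤ) - Finsupp.single T₁ 1)) ∈ L)
    (hR : ∃ T : Finset G, T ⊆ T₀.1 \ T₁.1 ∧ T.card = m ∧
      ∑ s ∈ T, Finsupp.single (oflipCM c hc2 s T₀) (1 : ℤ) - ∑ u ∈ (T₀.1 \ T₁.1) \ T, Finsupp.single (oflipCM c hc2 u T₁) (1 : ℤ) -
        ((m : ℤ) - 1) • (Finsupp.single T₀ (1 : ℤ) - Finsupp.single T₁ 1) ∈ L)
    (hRc : ∃ T' : Finset G, T' ⊆ T₀.1 ∩ T₁.1 ∧ T'.card = m ∧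
      ∑ s ∈ T', Finsupp.single (oflipCM c hc2 s T₀) (1 : ℤ) + ∑ u ∈ (T₀.1 ∩ T₁.1) \ T', Finsupp.single (oflipCM c hc2 u T₁) (1 : ℤ) -
        ((m : ℤ) - 1) • (Finsupp.single T₀ (1 : ℤ) + Finsupp.single T₁ 1) ∈ L) :
    ∀ y ∈ hodgeSpan c hc2, (∀ Ψ ∈ y.support, Ψ = T₀ ∨ Ψ = T₁ ∨ Ψ = rt c c T₀ ∨ Ψ = rt c c T₁ ∨
      ∃ s : G, Ψ = oflipCM c hc2 s T₀ ∨ Ψ = oflipCM c hc2 s T₁ ∨ Ψ = oflipCM c hc2 s (rt c c T₀) ∨ Ψ = oflipCM c hc2 s (rt c c T₁)) →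
      ((2 : ℤ) ^ k) • y ∈ L := by
  classical
  obtain ⟨T, hT, hTm, hRT⟩ := hR
  obtain ⟨T', hT', hT'm, hRT'⟩ := hRc
  set N : ℤ := (2 : ℤ) ^ k with hN
  -- the defects of the four base types
  have hρ₁ := smul_defect_T₁_mem c hc2 T₀ T₁ L N m hH hT hTm hRT fun t ht => hY t (mem_sdiff.mp ht).1
  have hσ := smul_sigma_mem c hc2 T₀ T₁ L N m hHc hT' hT'm hRT' fun t ht => hY' t (mem_sdiff.mp ht).1
  have hρ₀c := smul_defect_compl_T₀_mem c hc2 T₀ T₁ hcen L hP N hρ₁ hσ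
  -- defect of any flip of `T₁` at a place `s` (normalised into `T₀`)
  have hflip₁ : ∀ s : G, N • (Finsupp.single (oflipCM c hc2 s T₁) 1 -
      thetaG c hc2 T₀ (typeSum G c (Finsupp.single (oflipCM c hc2 s T₁) 1))) ∈ L := by
    suffices h : ∀ s ∈ T₀.1, N • (Finsupp.single (oflipCM c hc2 s T₁) 1 -
        thetaG c hc2 T₀ (typeSum G c (Finsupp.single (oflipCM c hc2 s T₁) 1))) ∈ L by
      intro s
      by_cases hs : s ∈ T₀.1
      · exact h s hs
      · have hcs : c * s ∈ T₀.1 := by by_contra h'; exact hs ((T₀.2 s).mpr h')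
        have e : oflipCM c hc2 s T₁ = oflipCM c hc2 (c * s) T₁ := (oflipCM_cmul c hc2 s T₁).symm
        rw [e]; exact h (c * s) hcs
    intro s hs
    by_cases hs1 : s ∈ T₁.1
    · exact smul_defect_oflipCM_T₁_mem_of_mem_inter c hc2 T₀ T₁ L N (mem_inter.mpr ⟨hs, hs1⟩) hρ₁ (hY' s (mem_inter.mpr ⟨hs, hs1⟩))
    · exact smul_defect_oflipCM_T₁_mem_of_mem_sdiff c hc2 T₀ T₁ L N (mem_sdiff.mpr ⟨hs, hs1⟩) hρ₁ (hY s (mem_sdiff.mpr ⟨hs, hs1⟩))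
  have hflip₀ : ∀ s : G, N • (Finsupp.single (oflipCM c hc2 s T₀) 1 -
      thetaG c hc2 T₀ (typeSum G c (Finsupp.single (oflipCM c hc2 s T₀) 1))) ∈ L := by
    intro s
    by_cases hs : s ∈ T₀.1
    · rw [defect_oflipCM_base c hc2 T₀ hs, smul_zero]; exact Submodule.zero_mem _
    · have hcs : c * s ∈ T₀.1 := by by_contra h'; exact hs ((T₀.2 s).mpr h')
      rw [← oflipCM_cmul c hc2 s T₀, defect_oflipCM_base c hc2 T₀ hcs, smul_zero]; exact Submodule.zero_mem _
  -- complements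
  have hcompl : ∀ X : CMF G c, N • (Finsupp.single X 1 - thetaG c hc2 T₀ (typeSum G c (Finsupp.single X 1))) ∈ L →
      N • (Finsupp.single (rt c c X) 1 - thetaG c hc2 T₀ (typeSum G c (Finsupp.single (rt c c X) 1))) ∈ L := by
    intro X hX
    rw [defect_compl c hc2 hcen T₀ X, smul_add, smul_sub, smul_sub]
    exact Submodule.add_mem _ (Submodule.sub_mem _ (Submodule.sub_mem _ (Submodule.smul_mem _ _ (hP X))
      (Submodule.smul_mem _ _ (hP T₀))) hX) hρ₀c
  -- assemble by defect closure
  refine two_pow_smul_mem_of_defects c hc2 hc1 hcen T₀ L hP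
    (fun Ψ => Ψ = T₀ ∨ Ψ = T₁ ∨ Ψ = rt c c T₀ ∨ Ψ = rt c c T₁ ∨
      ∃ s : G, Ψ = oflipCM c hc2 s T₀ ∨ Ψ = oflipCM c hc2 s T₁ ∨ Ψ = oflipCM c hc2 s (rt c c T₀) ∨ Ψ = oflipCM c hc2 s (rt c c T₁))
    (Or.inl rfl) (Or.inr (Or.inr (Or.inl rfl))) k fun X hX => ?_
  rcases hX with rfl | rfl | rfl | rfl | ⟨s, rfl | rfl | rfl | rfl⟩
  · rw [defect_base, smul_zero]; exact Submodule.zero_mem _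
  · exact hρ₁
  · exact hρ₀c
  · exact hcompl T₁ hρ₁
  · exact hflip₀ s
  · exact hflip₁ s
  · rw [oflipCM_rt_self c hc2 hcen]; exact hcompl _ (hflip₀ s)
  · rw [oflipCM_rt_self c hc2 hcen]; exact hcompl _ (hflip₁ s)

end

end Summit.HodgeConjecture.CorCM.Census.CentralSquares
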